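import Mathlib
import Summits.KontsevichZagierPeriods.KontsevichZagierPeriods.Theorems.InverseLandauTateFamilyKernelOpenCube
import Summits.KontsevichZagierPeriods.KontsevichZagierPeriods.Theorems.InverseLandauTateLiftingIntervalPolyPoint

/-!
# `TateLifting` (stmt-KontsevichZagierPeriods-9129), line `Sketch` — stub `stub_cylinderStokes`

THE CYLINDER STOKES STEP. Let `K = ℚ̄ ∩ ℝ` (`algebraicClosure ℚ ℝ`, the field of real algebraic
numbers). A CYLINDER representation is an honest representation `r` of dimension `n + 2` whose domain
is the open cube `∏ᵢ (0,1)` and whose integrand agrees there with `z ↦ P(z)/q(z₀)`, `P ∈ K[z₀,…,z_{n+1}]`,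
`q ∈ K[x]`, `q ≠ 0` on `[0,1]`. Assuming the tameness of all such integrands (analytic near the closed
cube, `ℚ`-semialgebraic on it: the registered stub `stub_cylinderTame`, taken here as a hypothesis),
one cubical Newton–Leibniz move along the LAST coordinate (`KZ.cubicalStokesGens`) integrates
`z_{n+1}` out and keeps the cylinder shape: with a polynomial primitive `∂G/∂z_{n+1} = P` in `K[z]`,
the primitive `F = G/q(z₀)` (the denominator does not involve the last variable) has
`∂F/∂z_{n+1} = P/q(z₀)` and `F(·,1) − F(·,0) = P′/q(z₀)` with
`P′ = G|_{z_{n+1}=1} − G|_{z_{n+1}=0} ∈ K[z₀,…,z_n]`. The passage between the open cube of the crux and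
the closed (tame) cube of the move is `TateFamilyKernel.of_sub_of_mem_relations_of_domain_eq_cube`.

References: M. Kontsevich, D. Zagier, *Periods* (2001), §1.2, rules (1) and (3); J. Ayoub, *Periods and
the conjectures of Grothendieck and Kontsevich–Zagier* (2014), Def. 10.
-/

noncomputable section

open MeasureTheory Set MvPolynomial
open Literature.ModelTheory.ExponentialFields (IsSemialgebraic)
open Literature.NumberTheory.Transcendental

namespace Summit.KontsevichZagierPeriods.InverseLandau

namespace CylinderStokes

/-! ### Polynomial calculus along the last coordinate

The polynomial primitive `∃ G, ∂ᵢ G = P` over the characteristic-zero field `K` is the landed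
`IntervalPoly.exists_pderiv_eq` (file `InverseLandauTateLiftingIntervalPolyPoint.lean`). -/

/-- Derivative of a polynomial along the last coordinate of a `snoc` point:
`d/ds G(x, s) = (∂_last G)(x, s)`. [folklore] -/
theorem hasDerivAt_aeval_snoc {K : Type*} [CommSemiring K] [Algebra K ℝ] {m : ℕ}
    (G : MvPolynomial (Fin (m + 1)) K) (x : Fin m → ℝ) (t : ℝ) :
    HasDerivAt (fun s : ℝ => aeval (Fin.snoc x s : Fin (m + 1) → ℝ) G)
      (aeval (Fin.snoc x t : Fin (m + 1) → ℝ) (pderiv (Fin.last m) G)) t := by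
  induction G using MvPolynomial.induction_on with
  | C a =>
    simp only [aeval_C, pderiv_C, map_zero]
    exact hasDerivAt_const t _
  | add p q hp hq =>
    simp only [map_add]
    exact hp.add hq
  | mul_X p i hp =>
    simp only [map_mul, aeval_X, pderiv_mul, map_add]
    induction i using Fin.lastCases with
    | last =>
      simp only [Fin.snoc_last, pderiv_X_self, map_one]
      exact hp.mul (hasDerivAt_id' t)
    | cast j =>
      simp only [Fin.snoc_castSucc, pderiv_X_of_ne (Fin.castSucc_lt_last j).ne, map_zero,
        mul_zero, add_zero]
      exact hp.mul_const (x j)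

/-- Evaluating the substitution of a constant `c` for the last variable: the substitution map
`(X₀, …, X_{m-1}, C c)` evaluates at `x` to the point `(x, c)`. [folklore] -/
theorem aeval_snoc_X_C {K S : Type*} [CommSemiring K] [CommSemiring S] [Algebra K S] {m : ℕ}
    (x : Fin m → S) (c : K) :
    (fun k => aeval x ((Fin.snoc (fun i => X i) (C c) : Fin (m + 1) → MvPolynomial (Fin m) K) k)) =
      (Fin.snoc x (algebraMap K S c) : Fin (m + 1) → S) := by
  funext k
  induction k using Fin.lastCases with
  | last => simp only [Fin.snoc_last, aeval_C]
  | cast i => simp only [Fin.snoc_castSucc, aeval_X]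

/-- Substituting a constant `c` for the last variable and evaluating is evaluating at `(x, c)`.
[folklore] -/
theorem aeval_bind₁_snoc {K S : Type*} [CommSemiring K] [CommSemiring S] [Algebra K S] {m : ℕ}
    (G : MvPolynomial (Fin (m + 1)) K) (x : Fin m → S) (c : K) :
    aeval x (bind₁ (Fin.snoc (fun i => X i) (C c) : Fin (m + 1) → MvPolynomial (Fin m) K) G) =
      aeval (Fin.snoc x (algebraMap K S c) : Fin (m + 1) → S) G := by
  rw [aeval_bind₁, aeval_snoc_X_C]

/-- Bookkeeping in the formal group: `[b] − [d] = −([a] − [b]) + ([a] − [c]) + ([c] − [d])`.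
[folklore] -/
theorem sub_mem_relations_of_chain {a b c d : KZ.FormalRep} (h₁ : a - b ∈ KZ.relations)
    (h₂ : a - c ∈ KZ.relations) (h₃ : c - d ∈ KZ.relations) : b - d ∈ KZ.relations := by
  have e : b - d = -(a - b) + (a - c) + (c - d) := by abel
  rw [e]
  exact KZ.relations.add_mem (KZ.relations.add_mem (KZ.relations.neg_mem h₁) h₂) h₃

/-! ### The step, in dimension `m + 1 + 1` -/

/-- **The cylinder Stokes step** (dimension written `m + 1 + 1`). Given the tameness of cylinder
integrands, a cylinder representation `[(0,1)^{m+2}, P(z)/q(z₀)]` differs by relations from the cylinder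
representation `[(0,1)^{m+1}, P′(z)/q(z₀)]`, `P′ = G(·,1) − G(·,0)` for a primitive `∂G/∂z_{m+1} = P`:
open cube ↔ tame closed cube on both sides (`TateFamilyKernel.of_sub_of_mem_relations_of_domain_eq_cube`)
and one move of `KZ.cubicalStokesGens` with the primitive `G/q(z₀)`.
[cite: KontsevichZagier2001, §1.2] -/
theorem step
    (hT : ∀ (n : ℕ) (P : MvPolynomial (Fin (n + 1)) (algebraicClosure ℚ ℝ))
      (q : Polynomial (algebraicClosure ℚ ℝ)),
      (∀ t ∈ Set.Icc (0 : ℝ) 1, Polynomial.aeval t q ≠ 0) →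
      AnalyticOnNhd ℝ (fun z : Fin (n + 1) → ℝ => MvPolynomial.aeval z P / Polynomial.aeval (z 0) q)
          (KZ.cube (n + 1)) ∧
        IsSemialgebraicFunOn ℚ (KZ.cube (n + 1))
          (fun z : Fin (n + 1) → ℝ => MvPolynomial.aeval z P / Polynomial.aeval (z 0) q))
    (m : ℕ) (P : MvPolynomial (Fin (m + 1 + 1)) (algebraicClosure ℚ ℝ))
    (q : Polynomial (algebraicClosure ℚ ℝ)) (r : KZ.IntegralRep (m + 1 + 1))
    (hq : ∀ t ∈ Set.Icc (0 : ℝ) 1, Polynomial.aeval t q ≠ 0)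
    (hd : r.domain = Set.pi Set.univ (fun _ => Set.Ioo (0 : ℝ) 1))
    (hi : Set.EqOn r.integrand
      (fun z => MvPolynomial.aeval z P / Polynomial.aeval (z 0) q) r.domain) :
    ∃ (P' : MvPolynomial (Fin (m + 1)) (algebraicClosure ℚ ℝ)) (r' : KZ.IntegralRep (m + 1)),
      r'.domain = Set.pi Set.univ (fun _ => Set.Ioo (0 : ℝ) 1) ∧
      Set.EqOn r'.integrand (fun z => MvPolynomial.aeval z P' / Polynomial.aeval (z 0) q)
        r'.domain ∧
      KZ.of r - KZ.of r' ∈ KZ.relations := by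
  -- appending a last coordinate does not change the first one (there are `m + 1 ≥ 1` others)
  have h0 : ∀ (x : Fin (m + 1) → ℝ) (t : ℝ), (Fin.snoc x t : Fin (m + 1 + 1) → ℝ) 0 = x 0 := by
    intro x t
    have h : (0 : Fin (m + 1 + 1)) = Fin.castSucc (0 : Fin (m + 1)) := rfl
    rw [h]
    exact Fin.snoc_castSucc (α := fun _ => ℝ) (p := x) (x := t) (i := 0)
  -- a polynomial primitive of `P` along the last variable, and its two faces
  obtain ⟨G, hG⟩ := IntervalPoly.exists_pderiv_eq (Fin.last (m + 1)) P
  obtain ⟨P', hP'⟩ : ∃ P' : MvPolynomial (Fin (m + 1)) (algebraicClosure ℚ ℝ),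
      P' = bind₁ (Fin.snoc (fun i => X i) (C 1) :
          Fin (m + 1 + 1) → MvPolynomial (Fin (m + 1)) (algebraicClosure ℚ ℝ)) G -
        bind₁ (Fin.snoc (fun i => X i) (C 0) :
          Fin (m + 1 + 1) → MvPolynomial (Fin (m + 1)) (algebraicClosure ℚ ℝ)) G :=
    ⟨_, rfl⟩
  -- tameness of the integrand, of the primitive and of the face difference (hypothesis)
  obtain ⟨hfa, hfs⟩ := hT (m + 1) P q hq
  obtain ⟨hFa, hFs⟩ := hT (m + 1) G q hq
  obtain ⟨hga, hgs⟩ := hT m P' q hq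
  -- the Newton–Leibniz move between the two tame closed cubes
  have h₂ : KZ.of (KZ.IntegralRep.tameCube _ hfa hfs) - KZ.of (KZ.IntegralRep.tameCube _ hga hgs) ∈
      KZ.relations := by
    refine KZ.cubicalStokesGens_subset_relations (KZ.mem_cubicalStokesGens
      (KZ.IntegralRep.isTameCube_tameCube _ hfa hfs) (KZ.IntegralRep.isTameCube_tameCube _ hga hgs)
      hFa hFs ?_ ?_)
    · intro x _ t _
      show HasDerivAt (fun s : ℝ => MvPolynomial.aeval (Fin.snoc x s : Fin (m + 1 + 1) → ℝ) G /
          Polynomial.aeval ((Fin.snoc x s : Fin (m + 1 + 1) → ℝ) 0) q)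
        (MvPolynomial.aeval (Fin.snoc x t : Fin (m + 1 + 1) → ℝ) P /
          Polynomial.aeval ((Fin.snoc x t : Fin (m + 1 + 1) → ℝ) 0) q) t
      simp only [h0]
      rw [← hG]
      exact (hasDerivAt_aeval_snoc G x t).div_const _
    · intro x _
      show MvPolynomial.aeval x P' / Polynomial.aeval (x 0) q =
        MvPolynomial.aeval (Fin.snoc x 1 : Fin (m + 1 + 1) → ℝ) G /
            Polynomial.aeval ((Fin.snoc x 1 : Fin (m + 1 + 1) → ℝ) 0) q -
          MvPolynomial.aeval (Fin.snoc x 0 : Fin (m + 1 + 1) → ℝ) G /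
            Polynomial.aeval ((Fin.snoc x 0 : Fin (m + 1 + 1) → ℝ) 0) q
      rw [h0, h0, hP', map_sub, aeval_bind₁_snoc, aeval_bind₁_snoc, map_one,
        map_zero, sub_div]
  -- open cube versus closed cube, on both sides
  have hE : IsSemialgebraic ℚ (Set.pi Set.univ fun _ : Fin (m + 1) => Set.Ioo (0 : ℝ) 1) := by
    rw [TateFamilyKernel.pi_univ_Ioo_eq_openUnitCube]
    exact isSemialgebraic_openUnitCube
  have hEsub : (Set.pi Set.univ fun _ : Fin (m + 1) => Set.Ioo (0 : ℝ) 1) ⊆ KZ.cube (m + 1) := by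
    rw [TateFamilyKernel.pi_univ_Ioo_eq_openUnitCube]
    exact KZ.openUnitCube_subset_cube
  have h₁ : KZ.of (KZ.IntegralRep.tameCube _ hfa hfs) - KZ.of r ∈ KZ.relations :=
    TateFamilyKernel.of_sub_of_mem_relations_of_domain_eq_cube _ r rfl hd hi
  have h₃ : KZ.of (KZ.IntegralRep.tameCube _ hga hgs) -
      KZ.of ((KZ.IntegralRep.tameCube _ hga hgs).restrict _ hE hEsub) ∈ KZ.relations :=
    TateFamilyKernel.of_sub_of_mem_relations_of_domain_eq_cube _ _ rfl rfl fun _ _ => rfl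
  exact ⟨P', (KZ.IntegralRep.tameCube _ hga hgs).restrict _ hE hEsub, rfl, fun _ _ => rfl,
    sub_mem_relations_of_chain h₁ h₂ h₃⟩

end CylinderStokes

/-- **The cylinder Stokes step** (`CylinderTame → CylinderStokes`, registered stub `stub_cylinderStokes`
of the line `Sketch`): assuming the tameness of cylinder integrands, a cylinder representation
`[(0,1)ⁿ⁺², P(z)/q(z₀)]` (`P ∈ K[z₀,…,z_{n+1}]`, `q ∈ K[x]`, `q ≠ 0` on `[0,1]`, `K = algebraicClosure ℚ ℝ`)
differs by relations of the Kontsevich–Zagier calculus from a cylinder representation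
`[(0,1)ⁿ⁺¹, P′(z)/q(z₀)]` in one variable less, `P′ = G(·,1) − G(·,0)` for a primitive `∂G/∂z_{n+1} = P`
(one Newton–Leibniz move along the last coordinate of the closed cube, and the open ↔ closed cube
passage across the null faces). [cite: KontsevichZagier2001, §1.2] -/
theorem tateLifting_cylinderStokes :
    (∀ (n : ℕ) (P : MvPolynomial (Fin (n + 1)) (algebraicClosure ℚ ℝ))
      (q : Polynomial (algebraicClosure ℚ ℝ)),
      (∀ t ∈ Set.Icc (0 : ℝ) 1, Polynomial.aeval t q ≠ 0) →
      AnalyticOnNhd ℝ (fun z : Fin (n + 1) → ℝ => MvPolynomial.aeval z P / Polynomial.aeval (z 0) q)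
          (KZ.cube (n + 1)) ∧
        IsSemialgebraicFunOn ℚ (KZ.cube (n + 1))
          (fun z : Fin (n + 1) → ℝ => MvPolynomial.aeval z P / Polynomial.aeval (z 0) q)) →
    ∀ (n : ℕ) (P : MvPolynomial (Fin (n + 2)) (algebraicClosure ℚ ℝ))
      (q : Polynomial (algebraicClosure ℚ ℝ)) (r : KZ.IntegralRep (n + 2)),
      (∀ t ∈ Set.Icc (0 : ℝ) 1, Polynomial.aeval t q ≠ 0) →
      r.domain = Set.pi Set.univ (fun _ => Set.Ioo (0 : ℝ) 1) →
      Set.EqOn r.integrand (fun z => MvPolynomial.aeval z P / Polynomial.aeval (z 0) q) r.domain →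
      ∃ (P' : MvPolynomial (Fin (n + 1)) (algebraicClosure ℚ ℝ)) (r' : KZ.IntegralRep (n + 1)),
        r'.domain = Set.pi Set.univ (fun _ => Set.Ioo (0 : ℝ) 1) ∧
        Set.EqOn r'.integrand (fun z => MvPolynomial.aeval z P' / Polynomial.aeval (z 0) q) r'.domain ∧
        KZ.of r - KZ.of r' ∈ KZ.relations := by
  intro hT n P q r hq hd hi
  exact CylinderStokes.step hT n P q r hq hd hi

end Summit.KontsevichZagierPeriods.InverseLandau

end
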